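import Summits.AtomisticToContinuum.BoseEinsteinCondensation.Theorems.BECCutLineWeakDisorderLateCoreSplitDefs
import Summits.AtomisticToContinuum.BoseEinsteinCondensation.Theorems.BECCutLineWeakDisorderLateCoreSplitOfCrux
import HarnessLib

/-! Scratch (strategist p1): the route-level children of the split of `TwoReplicaTransienceBound`,
written EXACTLY as they will appear in the route file (fully qualified, no Theorems vocabulary), and the
check that the LANDED composition `LateCoreSplit.TwoReplicaTransienceBound_of` (p139781) has their type up to
definitional unfolding (`--glue-by`). -/

namespace Summit.AtomisticToContinuum.BoseEinsteinCondensation.Theses.BECCutLineWeakDisorder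

open scoped BigOperators Topology Manifold Classical MeasureTheory ProbabilityTheory Matrix InnerProductSpace ComplexConjugate ContinuousMap
open Filter Set Function TopologicalSpace MeasureTheory

/-- Z (child 1). -/
def HeatFlowZeroMode : Prop :=
  ∀ v : ℝ → ENNReal, Literature.MathematicalPhysics.QuantumManyBody.BoseGas.IsRepulsiveFiniteRange v → ∃ ρ₀ : ℝ, 0 < ρ₀ ∧ ∀ ρ : ℝ, 0 < ρ → ρ < ρ₀ → ∃ c : ℝ, 0 < c ∧ ∀ᶠ n : ℕ in Filter.atTop, ∀ᶠ T : ℝ in Filter.atTop, ENNReal.ofReal (c * Literature.MathematicalPhysics.QuantumManyBody.BoseGas.sideLength ρ (n + 1) ^ 3) ≤ ∫⁻ Y : Literature.MathematicalPhysics.QuantumManyBody.BoseGas.Config n, (∫⁻ x, (‖Literature.MathematicalPhysics.QuantumManyBody.BoseGas.fkWitness (N := n + 1) v (Literature.MathematicalPhysics.QuantumManyBody.BoseGas.sideLength ρ (n + 1)) T (fun _ => (1 : ENNReal)) (Matrix.vecCons x Y)‖₊ : ENNReal)) ^ 2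

/-- A (child 2). -/
def HeatFlowNoIntermittency : Prop :=
  ∀ v : ℝ → ENNReal, Literature.MathematicalPhysics.QuantumManyBody.BoseGas.IsRepulsiveFiniteRange v → ∃ ρ₀ : ℝ, 0 < ρ₀ ∧ ∀ ρ : ℝ, 0 < ρ → ρ < ρ₀ → ∃ C₂ : ℝ, 0 < C₂ ∧ ∀ᶠ n : ℕ in Filter.atTop, ∀ᶠ T : ℝ in Filter.atTop, (∫⁻ Y : Literature.MathematicalPhysics.QuantumManyBody.BoseGas.Config n, ENNReal.ofReal (Literature.MathematicalPhysics.QuantumManyBody.BoseGas.sideLength ρ (n + 1) ^ 3) * (∫⁻ x, (‖Literature.MathematicalPhysics.QuantumManyBody.BoseGas.fkWitness (N := n + 1) v (Literature.MathematicalPhysics.QuantumManyBody.BoseGas.sideLength ρ (n + 1)) T (fun _ => (1 : ENNReal)) (Matrix.vecCons x Y)‖₊ : ENNReal) ^ 2) ^ 2 / (∫⁻ x, (‖Literature.MathematicalPhysics.QuantumManyBody.BoseGas.fkWitness (N := n + 1) v (Literature.MathematicalPhysics.QuantumManyBody.BoseGas.sideLength ρ (n + 1)) T (fun _ => (1 :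 ENNReal)) (Matrix.vecCons x Y)‖₊ : ENNReal)) ^ 2) * (∫⁻ Y : Literature.MathematicalPhysics.QuantumManyBody.BoseGas.Config n, (∫⁻ x, (‖Literature.MathematicalPhysics.QuantumManyBody.BoseGas.fkWitness (N := n + 1) v (Literature.MathematicalPhysics.QuantumManyBody.BoseGas.sideLength ρ (n + 1)) T (fun _ => (1 : ENNReal)) (Matrix.vecCons x Y)‖₊ : ENNReal)) ^ 2) ≤ ENNReal.ofReal C₂ * ENNReal.ofReal (Literature.MathematicalPhysics.QuantumManyBody.BoseGas.sideLength ρ (n + 1) ^ 3)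

/-- O (child 3). -/
def HeatFlowNoOvershoot : Prop :=
  ∀ v : ℝ → ENNReal, Literature.MathematicalPhysics.QuantumManyBody.BoseGas.IsRepulsiveFiniteRange v → ∃ ρ₀ : ℝ, 0 < ρ₀ ∧ ∀ ρ : ℝ, 0 < ρ → ρ < ρ₀ → ∃ C₀ : ℝ, 0 < C₀ ∧ ∀ᶠ n : ℕ in Filter.atTop, ∀ T T' : ℝ, 1 ≤ T → T ≤ T' → (∫⁻ Y : Literature.MathematicalPhysics.QuantumManyBody.BoseGas.Config n, ENNReal.ofReal (Literature.MathematicalPhysics.QuantumManyBody.BoseGas.sideLength ρ (n + 1) ^ 3) * (∫⁻ x, (‖Literature.MathematicalPhysics.QuantumManyBody.BoseGas.fkWitness (N := n + 1) v (Literature.MathematicalPhysics.QuantumManyBody.BoseGas.sideLength ρ (n + 1)) T (fun _ => (1 : ENNReal)) (Matrix.vecCons x Y)‖₊ : ENNReal) ^ 2) ^ 2 / (∫⁻ x, (‖Literature.MathematicalPhysics.QuantumManyBody.BoseGas.fkWitness (N := n + 1) v (Literature.MathematicalPhysics.QuantumManyBody.BoseGas.sideLength ρ (n + 1)) T (fun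 _ => (1 : ENNReal)) (Matrix.vecCons x Y)‖₊ : ENNReal)) ^ 2) ≤ ENNReal.ofReal C₀ * (1 + (∫⁻ Y : Literature.MathematicalPhysics.QuantumManyBody.BoseGas.Config n, ENNReal.ofReal (Literature.MathematicalPhysics.QuantumManyBody.BoseGas.sideLength ρ (n + 1) ^ 3) * (∫⁻ x, (‖Literature.MathematicalPhysics.QuantumManyBody.BoseGas.fkWitness (N := n + 1) v (Literature.MathematicalPhysics.QuantumManyBody.BoseGas.sideLength ρ (n + 1)) T' (fun _ => (1 : ENNReal)) (Matrix.vecCons x Y)‖₊ : ENNReal) ^ 2) ^ 2 / (∫⁻ x, (‖Literature.MathematicalPhysics.QuantumManyBody.BoseGas.fkWitness (N := n + 1) v (Literature.MathematicalPhysics.QuantumManyBody.BoseGas.sideLength ρ (n + 1)) T' (fun _ => (1 : ENNReal)) (Matrix.vecCons x Y)‖₊ : ENNReal)) ^ 2))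

/-- The children are, up to unfolding, the landed `LateCoreSplit` statements. -/
example : HeatFlowZeroMode ↔ Summit.AtomisticToContinuum.BoseEinsteinCondensation.Cruxes.TwoReplicaTransienceBound.LateCoreSplit.WitnessZeroMode := Iff.rfl
example : HeatFlowNoIntermittency ↔ Summit.AtomisticToContinuum.BoseEinsteinCondensation.Cruxes.TwoReplicaTransienceBound.LateCoreSplit.OverlapNoIntermittency := Iff.rfl
example : HeatFlowNoOvershoot ↔ Summit.AtomisticToContinuum.BoseEinsteinCondensation.Cruxes.TwoReplicaTransienceBound.LateCoreSplit.NoTransientOvershoot := Iff.rfl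

/-- The split glue BY NAME from the landed composition (what `--glue-by` must check). -/
theorem TwoReplicaTransienceBound_of_subs :
    HeatFlowZeroMode → HeatFlowNoIntermittency → HeatFlowNoOvershoot → TwoReplicaTransienceBound :=
  Summit.AtomisticToContinuum.BoseEinsteinCondensation.Cruxes.TwoReplicaTransienceBound.LateCoreSplit.TwoReplicaTransienceBound_of

/-- Safety (every child is crux-implied; landed p140379 `stub_splitOfCrux`). -/
example : TwoReplicaTransienceBound → HeatFlowZeroMode ∧ HeatFlowNoIntermittency ∧ HeatFlowNoOvershoot :=
  fun h => ⟨(Summit.AtomisticToContinuum.BoseEinsteinCondensation.Cruxes.TwoReplicaTransienceBound.LateCoreSplit.stub_splitOfCrux.mp h).1, (Summit.AtomisticToContinuum.BoseEinsteinCondensation.Cruxes.TwoReplicaTransienceBound.LateCoreSplit.stub_splitOfCrux.mp h).2.1, (Summit.AtomisticToContinuum.BoseEinsteinCondensation.Cruxes.TwoReplicaTransienceBound.LateCoreSplit.stub_splitOfCrux.mp h).2.2⟩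

end Summit.AtomisticToContinuum.BoseEinsteinCondensation.Theses.BECCutLineWeakDisorder
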